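import Mathlib.NumberTheory.Zsqrtd.GaussianInt
import Mathlib.Tactic.Ring
import Mathlib.Tactic.Linarith
import Mathlib.Tactic.Positivity
import Mathlib.Tactic.FinCases
import Mathlib.Tactic.CasesM

/-!
# Venture HSemireg — PAD-4 first-order PHASE KERNEL: the exact `ℤ[i]` linear-algebra tables behind THEOREM L^ζ §5
# (the referee's «144 phase cases», here for charges `1…5`), the Q̃ escape, the symmetric-sub-model caveat O5, and the
# effectivity rule (P0) ∕ layer line (LL) for ALL charges — kernel `decide`, `ring`, `nlinarith`; standard axioms only

HONEST FRAMING. Certificate file of the COMPUTATION cell `pub-hsemireg` (general-structure seat gs-eng-2 g48, by ORDER of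
director-hodge g7, cell INBOX l.29811 ∕ l.29819 «TIER 1 FILE B»; keeper FILER). It types, as Lean DEFINITIONS over Mathlib's
Gaussian integers `ℤ[i]` and with NO `native_decide`, the finite exact linear algebra that the cell's pencil theorem
**THEOREM L^ζ** (s4-search-1, `s4push∕search-1∕PAD4-THEOREM-L-search-1.md` v1.2 sha16 `66fb170a6cb906b7`, §5 (P0)–(P3) and
§6; referee reads ×2 independent: s4-ref-2 g3 `a0ec94ca101589e9`, s4-ref g66 `7768f9be2797e6b7`; census HEAD v6.1
`a947beb21966a48c`, state «y») uses at its two «phase» steps, and re-proves IN THE KERNEL the machine leg of the second referee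
(`s4push∕s4ref-g66∕lzeta∕phase_leak_check.py` sha16 `a5f66f8f17b9981a`: «C′(≤) 144∕144, (L1) 144∕144, f-leg∕s-leg 144∕144,
Q̃ 12, symmetric sub-model 4 + 12, (P0) 784, (LL) 1 568»). THE MODEL (FIRSTORDER §1, THEOREM-L (6.6)(i)(iii), entered BY VALUE
as definitions): `S⁴ = Π_g S_g`, `S_g = E_A × E_B`, `E = ℂ∕ℤ[i]`; `V_g = H^{0,1}(S_g) = ⟨ē_{A_g}, ē_{B_g}⟩`; a Weil tangent direction
`κ ∈ T_W ≅ M₄` is a matrix `k = (k_{jg})` with `κ(e_{A_g}) = Σ_j k_{jg} ē_{B_j}`, `κ(e_{B_j}) = Σ_g k_{jg} ē_{A_g}` (all 16 entries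
free); the null letter `ℓ_ζ = (1,ζ)(1,ζ)^* = [[1, ζ̄],[ζ, 1]]`, `ζ ∈ μ₄`, has `ξ_ζ = e_A + ζ e_B`, `ξ̄_ζ = ē_A + ζ̄ ē_B`, and the
first-order class of a constituent `X = Σ_g c_g ℓ_{ζ_g}^{(g)}` in direction `κ` is `(κ ∪ c₁X)^{0,2} = Σ_g c_g · κ(ξ_g) ∧ ξ̄_g`; its
`(s,f)`-PIECE is the component in `V_s ⊗ V_f ⊂ Λ² H^{0,1}`. WHAT IS CERTIFIED (theorems, `decide` unless said otherwise):
* `cprime_containment` — C′(⇒): for a flag `X = a ℓ_{ζs}^{(s)} + h ℓ_{ζf}^{(f)}` every direction's pair piece decomposes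
  EXPLICITLY as `ξ̄_{ζs} ⊗ u + v ⊗ ξ̄_{ζf}` (16 phase pairs × 25 charge pairs `(a,h) ∈ {1,…,5}²` × 16 directions `E_{pq}`);
* `leak_demand` — (L1)∕(P2): for every phase pair and charge pair some direction has `(id ⊗ ℓ_{ζf})(piece) ≠ 0`, so the
  image is NOT inside `V_s ⊗ Ξ_f` (soundness of the test: `contractF_tens_xib`, `contractF_add`) — the LEAK demand of
  THEOREM L^ζ at a top flag is available in the full `T_W`; `fleg_needed` — likewise not inside `Ξ_s ⊗ V_f` (C′ only-if);
* `qtilde_escape` — (P3): the `(f,τ)`-pieces of `Im(Q̃)`, `Q̃ = h ℓ_ζ^{(f)}`, are `ξ̄_ζ ⊗ u` and two directions give independent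
  `u` — they span `ξ̄_f ⊗ V_τ` (dim 2), outside every σ-plane; charges `h ∈ {1,…,5}`;
* `symmetric_submodel_leak_vanishes_iff` — O5 ∕ (6.6)(iii) CAUTION: in the symmetric sub-model `k = kᵀ` the (L1) test dies in
  every direction iff `ζs = ζf` (so L^ζ as written is a statement for the FULL `T_W`);
* `effectivity_rule` — (P0), ALL charges (`fin_cases` + `nlinarith`): `c ℓ_ζ − c′ ℓ_{ζ′}` psd iff `c′ = 0 ∨ (ζ = ζ′ ∧ c′ ≤ c)` — the
  factorwise rule behind «N − P effective» and the 9 232 dominant pairs of supp D₄₅ ((6.7)(i)); `effectivity_rule_table` = the 784 cases;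
* `layer_eigenvalue_sign` — (LL), ALL shifts `s ≠ 0` and charges: `s·I₂ + (c ℓ_ζ − c′ ℓ_{ζ′})` has an eigenvalue of the strict
  sign of `s` (squared form); `layer_eigenvalue_sign_table` = `s = ±1…±6`, `c, c′ ≤ 6`.
* §A4, CHARGE-FREE FORMS (the two «phase» steps of L^ζ for EVERY height): `cprime_containment_all` and `qtilde_in_plane_all`
  are ring identities for every `κ ∈ T_W` (any matrix) and all charges; `leak_demand_all_charges` (∀ `a ≥ 1`, `h ≥ 0`) and
  `qtilde_escape_all_charges` (∀ `h ≥ 1`) follow by linearity (`contractF_imPiece`, `qtilde_det_smul`) from unit-charge tables,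
  the (L1) witness being the single direction `κ₀ = E_{fs}` (`k_{fσ} = 1`, THEOREM-L [O6]) for every phase pair.
The D₄₅ flags `(a, h) = (1, 4)` and servers `5` (companion file `Pad4D45Certificate`) are inside the tables anyway. Factor labels
are fixed as in the referee's script (`s = 0`, `f = 1`, `τ = 2`); the model is `S₄`-symmetric in the labels. WHAT IS NOT HERE: THEOREM L^ζ itself (its statement-only MODEL is the typer's FILE A
`Pad4FirstOrderModel`; its proof — top flag, FULL(X), the rows (R1)(R2), the change of splitting `Aut(E₊)` — is pencil ×2, not
Lean), the section rings ∕ LEAK §1 type calculus, any sheaf, `Ext` group, semiregularity map `σ`, seed, or abelian variety beyond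
this linear-algebra shadow, and any claim about HC ∕ HC_CM ∕ HC_AV — NOTHING HERE SAYS ANY OF THOSE IS PROVED. No `instance`,
no notation, no named fact, 0 `sorry`.
-/

namespace Summit.Ventures.HSemireg.Pad4PhaseKernel

open GaussianInt

/-! ## §A0 The pair-(σ,f) model over `ℤ[i]` (FIRSTORDER §1 ∕ THEOREM-L v1.2 (6.6)(i)(iii)) -/

/-- The phase `ζ = i^k ∈ μ₄ ⊂ ℤ[i]`, indexed by `k : Fin 4` (`0 ↦ 1, 1 ↦ i, 2 ↦ −1, 3 ↦ −i`). [model datum] -/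
def phase : Fin 4 → GaussianInt
  | 0 => 1
  | 1 => ⟨0, 1⟩
  | 2 => -1
  | 3 => ⟨0, -1⟩

/-- A vector of one factor's `V_g = H^{0,1}(S_g) = ⟨ē_{A_g}, ē_{B_g}⟩`: the pair (A-coefficient, B-coefficient). [model datum] -/
abbrev Vec2 := GaussianInt × GaussianInt

/-- A vector of the pair piece `V_s ⊗ V_f` (coefficients on `ē_{A_s}∧ē_{A_f}, ē_{A_s}∧ē_{B_f}, ē_{B_s}∧ē_{A_f}, ē_{B_s}∧ē_{B_f}`). [model datum] -/
structure Vec4 where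
  /-- coefficient on `ē_{A_s} ∧ ē_{A_f}` -/
  aa : GaussianInt
  /-- coefficient on `ē_{A_s} ∧ ē_{B_f}` -/
  ab : GaussianInt
  /-- coefficient on `ē_{B_s} ∧ ē_{A_f}` -/
  ba : GaussianInt
  /-- coefficient on `ē_{B_s} ∧ ē_{B_f}` -/
  bb : GaussianInt
deriving DecidableEq, Repr

/-- Sum of two vectors of `V_s ⊗ V_f`. [model datum] -/
def Vec4.add (x y : Vec4) : Vec4 := ⟨x.aa + y.aa, x.ab + y.ab, x.ba + y.ba, x.bb + y.bb⟩

/-- Scalar multiple of a vector of `V_s ⊗ V_f`. [model datum] -/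
def Vec4.smul (c : GaussianInt) (x : Vec4) : Vec4 := ⟨c * x.aa, c * x.ab, c * x.ba, c * x.bb⟩

/-- The pure tensor `u ⊗ v ∈ V_s ⊗ V_f` of two factor vectors. [model datum] -/
def tens (u v : Vec2) : Vec4 := ⟨u.1 * v.1, u.1 * v.2, u.2 * v.1, u.2 * v.2⟩

/-- An element of `H^{0,1}(S⁴) = ⊕_g V_g`: its four factor components. [model datum] -/
abbrev H01 := Fin 4 → Vec2

/-- A Weil tangent direction `κ ∈ T_W ≅ M₄`: the matrix `k = (k_{jg})` over `ℤ[i]` ((6.6)(iii): all 16 entries independent). [model datum] -/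
abbrev TW := Fin 4 → Fin 4 → GaussianInt

/-- The elementary matrix `E_{ab}` (`k_{ab} = 1`, all other entries `0`) — the basis of `T_W` used for the tables. [model datum] -/
def stdDir (a b : Fin 4) : TW := fun j g => if j = a ∧ g = b then 1 else 0

/-- The symmetric direction `E_{ab} + E_{ba}` (for `a ≠ b`; `E_{aa}` when `a = b`) — basis of the 10-dimensional SYMMETRIC sub-model
`k = kᵀ` of (6.6)(iii) CAUTION ∕ referee O5. [model datum] -/
def symDir (a b : Fin 4) : TW := fun j g => if (j = a ∧ g = b) ∨ (j = b ∧ g = a) then 1 else 0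

/-- `κ(e_{A_g}) = Σ_j k_{jg} ē_{B_j}` (FIRSTORDER §1): as an element of `⊕_j V_j` it has B-coefficient `k_{jg}` on factor `j`. [model datum] -/
def kappaA (k : TW) (g : Fin 4) : H01 := fun j => (0, k j g)

/-- `κ(e_{B_g}) = Σ_j k_{gj} ē_{A_j}` (FIRSTORDER §1): A-coefficient `k_{gj}` on factor `j`. [model datum] -/
def kappaB (k : TW) (g : Fin 4) : H01 := fun j => (k g j, 0)

/-- `κ(ξ_g)` for `ξ_g = e_{A_g} + ζ e_{B_g}` (the holomorphic null vector of the letter `ℓ_ζ` on factor `g`, (6.6)(i)). [model datum] -/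
def kappaXi (k : TW) (g : Fin 4) (ζ : GaussianInt) : H01 :=
  fun j => ((kappaA k g j).1 + ζ * (kappaB k g j).1, (kappaA k g j).2 + ζ * (kappaB k g j).2)

/-- `ξ̄_g = ē_{A_g} + ζ̄ ē_{B_g}` on factor `g` (zero on the other factors), (6.6)(i). [model datum] -/
def xibar (g : Fin 4) (ζ : GaussianInt) : H01 := fun j => if j = g then (1, star ζ) else (0, 0)

/-- The factor vector `ξ̄_ζ = (1, ζ̄) ∈ V`. [model datum] -/
def xib (ζ : GaussianInt) : Vec2 := (1, star ζ)

/-- The `(s,f)`-piece (`s ≠ f`) of `u ∧ w` for `u, w ∈ H^{0,1}(S⁴)`: the coefficient on `ē_{s,p} ∧ ē_{f,q}` is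
`u_{s,p} w_{f,q} − w_{s,p} u_{f,q}`. [model datum] -/
def wedgePiece (u w : H01) (s f : Fin 4) : Vec4 :=
  ⟨(u s).1 * (w f).1 - (w s).1 * (u f).1, (u s).1 * (w f).2 - (w s).1 * (u f).2,
   (u s).2 * (w f).1 - (w s).2 * (u f).1, (u s).2 * (w f).2 - (w s).2 * (u f).2⟩

/-- The `(s,f)`-piece of the first-order class `(κ ∪ c₁X)^{0,2} = Σ_g c_g · κ(ξ_g) ∧ ξ̄_g` of a constituent charged `cs·ℓ_{ζs}` on
factor `s` and `cf·ℓ_{ζf}` on factor `f` (DIAGCLOSURE §0 image formula; charges on third factors do not reach this piece when `κ`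
runs over `T_W`, they are omitted). [model datum] -/
def imPiece (s f : Fin 4) (cs ζs cf ζf : GaussianInt) (k : TW) : Vec4 :=
  Vec4.add (Vec4.smul cs (wedgePiece (kappaXi k s ζs) (xibar s ζs) s f))
           (Vec4.smul cf (wedgePiece (kappaXi k f ζf) (xibar f ζf) s f))

/-! ## §A1 Linear tests and their soundness (what «∈ plane» ∕ «∉ V_s ⊗ Ξ_f» means in the tables) -/

/-- `(id ⊗ ℓ_{ζf})(w) ∈ V_s` with `ℓ_ζ(x_A, x_B) = ζ̄·x_A − x_B` (kills `ξ̄_ζ = (1, ζ̄)`): vanishes on `V_s ⊗ ξ̄_{ζf}` (`contractF_tens_xib`), so a NON-zero value certifies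
`w ∉ V_s ⊗ Ξ_f`, `Ξ_f = ⟨ξ̄_{ζf}⟩`. [model datum] -/
def contractF (ζf : GaussianInt) (w : Vec4) : Vec2 := (star ζf * w.aa - w.ab, star ζf * w.ba - w.bb)

/-- `(ℓ_{ζs} ⊗ id)(w) ∈ V_f`: vanishes on `ξ̄_{ζs} ⊗ V_f` (lemma `contractS_tens_xib`), so a NON-zero value certifies
`w ∉ Ξ_s ⊗ V_f`. [model datum] -/
def contractS (ζs : GaussianInt) (w : Vec4) : Vec2 := (star ζs * w.aa - w.ba, star ζs * w.ab - w.bb)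

/-- Candidate decomposition `w = ξ̄_{ζs} ⊗ u + v ⊗ ξ̄_{ζf}` with `v_A = 0`: returns `(u, v)`; whether it recomposes to `w` is
CHECKED case by case (theorem `cprime_containment`), nothing is assumed. [model datum] -/
def decomp (ζs : GaussianInt) (w : Vec4) : Vec2 × Vec2 := ((w.aa, w.ab), (0, w.ba - star ζs * w.aa))

/-- `ξ̄_{ζs} ⊗ u + v ⊗ ξ̄_{ζf}`. [model datum] -/
def recompose (ζs ζf : GaussianInt) (uv : Vec2 × Vec2) : Vec4 := Vec4.add (tens (xib ζs) uv.1) (tens uv.2 (xib ζf))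

/-- SOUNDNESS of the F-test: `(id ⊗ ℓ_ζ)(v ⊗ ξ̄_ζ) = 0` for every `v`. [kernel, `ring`] -/
theorem contractF_tens_xib (ζ : GaussianInt) (v : Vec2) : contractF ζ (tens v (xib ζ)) = (0, 0) := by
  simp only [contractF, tens, xib, Prod.mk.injEq]; constructor <;> ring

/-- SOUNDNESS of the S-test: `(ℓ_ζ ⊗ id)(ξ̄_ζ ⊗ u) = 0` for every `u`. [kernel, `ring`] -/
theorem contractS_tens_xib (ζ : GaussianInt) (u : Vec2) : contractS ζ (tens (xib ζ) u) = (0, 0) := by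
  simp only [contractS, tens, xib, Prod.mk.injEq]; constructor <;> ring

/-- The F-test is additive. [kernel, `ring`] -/
theorem contractF_add (ζ : GaussianInt) (x y : Vec4) :
    contractF ζ (Vec4.add x y) = ((contractF ζ x).1 + (contractF ζ y).1, (contractF ζ x).2 + (contractF ζ y).2) := by
  simp only [contractF, Vec4.add, Prod.mk.injEq]; constructor <;> ring

/-- The S-test is additive. [kernel, `ring`] -/
theorem contractS_add (ζ : GaussianInt) (x y : Vec4) :
    contractS ζ (Vec4.add x y) = ((contractS ζ x).1 + (contractS ζ y).1, (contractS ζ x).2 + (contractS ζ y).2) := by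
  simp only [contractS, Vec4.add, Prod.mk.injEq]; constructor <;> ring

/-! ## §A2 The phase tables (16 phase pairs × 25 charge pairs `(a,h) ∈ {1,…,5}²` ⊇ the referee's 144 cases, 16 directions
`E_{pq}` each; factors `s = 0`, `f = 1`, third factor `τ = 2` as in the referee's script — the model is `S₄`-symmetric in the labels) -/

/-- The charge `c ∈ {1, …, 5}` indexed by `Fin 5` (`c ↦ c + 1`), as an element of `ℤ[i]` (the referee's table has `{1,2,3}`;
`5` covers the D₄₅ flags `(1,4)` and servers `5`). [model datum] -/
def charge (c : Fin 5) : GaussianInt := (c.val + 1 : ℕ)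

/-- The flag's pair piece in direction `E_{ab}`: `X = a·ℓ_{ζs}^{(0)} + h·ℓ_{ζf}^{(1)}`, piece `(0,1)`. [model datum] -/
def flagPiece (zs zf : Fin 4) (a h : Fin 5) (p q : Fin 4) : Vec4 :=
  imPiece 0 1 (charge a) (phase zs) (charge h) (phase zf) (stdDir p q)

/-- **TABLE C′(≤) (400 cases × 16 directions ⊇ the referee's 144 × 16).** For every phase pair, charge pair and direction `E_{pq}` the pair piece of the flag
`X = a ℓ_{ζs}^{(s)} + h ℓ_{ζf}^{(f)}` decomposes EXPLICITLY as `ξ̄_{ζs} ⊗ u + v ⊗ ξ̄_{ζf}` — i.e. lies in the plane sum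
`Ξ_s ⊗ V_f + V_s ⊗ Ξ_f` of THEOREM C′ (⇒). (s4-ref g66 check «C′(≤) … 144∕144».) [kernel, `decide`] -/
theorem cprime_containment :
    ∀ zs zf : Fin 4, ∀ a h : Fin 5, ∀ p q : Fin 4,
      recompose (phase zs) (phase zf) (decomp (phase zs) (flagPiece zs zf a h p q)) = flagPiece zs zf a h p q := by
  decide +kernel

/-- **TABLE (L1) (400 ⊇ 144 cases).** For every phase pair and charge pair SOME direction `E_{pq}` has non-zero F-test, i.e. the image
of the flag is NOT inside `V_s ⊗ Ξ_f`: the LEAK demand `a·ξ̄_{ζs} ⊗ [κ(ξ_{ζs})_f mod Ξ_f] ≠ 0` of THEOREM L^ζ §2 (L1) ∕ (P2) is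
available for a suitable `κ ∈ T_W` — equivalently the «C′ only-if: s-leg needed» line of the referee. [kernel, `decide`] -/
theorem leak_demand :
    ∀ zs zf : Fin 4, ∀ a h : Fin 5, ∃ p q : Fin 4, contractF (phase zf) (flagPiece zs zf a h p q) ≠ (0, 0) := by
  decide +kernel

/-- **TABLE f-leg (400 ⊇ 144 cases).** For every phase pair and charge pair SOME direction has non-zero S-test: the image of the flag is
NOT inside `Ξ_s ⊗ V_f`, so an `f`-partner is needed («C′ only-if: f-leg needed»). [kernel, `decide`] -/
theorem fleg_needed :
    ∀ zs zf : Fin 4, ∀ a h : Fin 5, ∃ p q : Fin 4, contractS (phase zs) (flagPiece zs zf a h p q) ≠ (0, 0) := by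
  decide +kernel


/-- The decomposition used for Q̃: `w = ξ̄_{ζf} ⊗ u` with `u = (w_{AA}, w_{AB})` read off the first two coordinates. [model datum] -/
def qtildeU (w : Vec4) : Vec2 := (w.aa, w.ab)

/-- The `(f,τ)`-piece (`f = 1`, `τ = 2`) of `Im(Q̃)`, `Q̃ = h·ℓ_{ζf}^{(f)}` charged on `f` only, in direction `E_{pq}`. [model datum] -/
def qtildePiece (zf : Fin 4) (h : Fin 5) (p q : Fin 4) : Vec4 := imPiece 1 2 (charge h) (phase zf) 0 0 (stdDir p q)

/-- **TABLE Q̃ (20 ⊇ 12 cases).** For every `f`-phase and charge: every direction's `(f,τ)`-piece of `Im(Q̃)` is `ξ̄_{ζf} ⊗ u` for the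
explicit `u = qtildeU`, and the two directions `E_{τf}`, `E_{fτ}` give `u`-vectors with non-zero determinant — so the pieces
span EXACTLY `ξ̄_f ⊗ V_τ` (dimension 2); in particular `h ξ̄_ζ ⊗ κ(ξ_ζ)_τ ≠ 0` for suitable `κ`, the (P3) escape of THEOREM L^ζ
(no σ-plane `ξ̄^{(σ)} ∧ Λ¹` has a `V_f ⊗ V_τ` part). (s4-ref g66 «Qtilde (f,tau)-piece = xibar_f(x)V_tau, dim 2: 12 cases».)
[kernel, `decide`] -/
theorem qtilde_escape :
    ∀ zf : Fin 4, ∀ h : Fin 5,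
      (∀ p q : Fin 4, tens (xib (phase zf)) (qtildeU (qtildePiece zf h p q)) = qtildePiece zf h p q) ∧
      (qtildeU (qtildePiece zf h 2 1)).1 * (qtildeU (qtildePiece zf h 1 2)).2
        - (qtildeU (qtildePiece zf h 2 1)).2 * (qtildeU (qtildePiece zf h 1 2)).1 ≠ 0 := by
  decide +kernel

/-- **TABLE O5 (symmetric sub-model, 16 phase pairs).** In the 10-dimensional SYMMETRIC sub-model `k = kᵀ` (directions
`E_{pq} + E_{qp}`) the F-test of the flag's pair piece vanishes in EVERY symmetric direction exactly when the two phases are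
EQUAL (`ζs = ζf`: 4 pairs), and survives for the other 12 — referee O5 ∕ (6.6)(iii) CAUTION («THEOREM L^ζ as written is a
statement for the full `T_W ≅ M₄`»). Charges `(a,h) ∈ {1,…,5}²`. [kernel, `decide`] -/
theorem symmetric_submodel_leak_vanishes_iff :
    ∀ zs zf : Fin 4,
      (∀ a h : Fin 5, ∀ p q : Fin 4,
          contractF (phase zf) (imPiece 0 1 (charge a) (phase zs) (charge h) (phase zf) (symDir p q)) = (0, 0)) ↔ zs = zf := by
  decide +kernel

/-! ## §A3 The effectivity rule (P0) and the layer-locality eigenvalue line (LL) — integer tables -/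

/-- The letter difference `c·ℓ_ζ − c′·ℓ_{ζ′} = [[d, w̄],[w, d]]` on one factor (`d = c − c′`, `w = cζ − c′ζ′`; `ℓ_ζ = [[1, ζ̄],[ζ, 1]]`,
(6.6)(i)) is positive semi-definite iff `d ≥ 0` and `det = d² − |w|² ≥ 0` (a `2 × 2` Hermitian matrix with equal diagonal
entries). Boolean test, exact in `ℤ[i]` (`Zsqrtd.norm = |w|²`). [model datum] -/
def letterDiffPSD (c : ℕ) (z : Fin 4) (c' : ℕ) (z' : Fin 4) : Bool :=
  decide (0 ≤ (c : ℤ) - c') &&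
    decide (((c : GaussianInt) * phase z - (c' : GaussianInt) * phase z').norm ≤ ((c : ℤ) - c') * ((c : ℤ) - c'))

/-- **TABLE (P0) (784∕784).** For charges `c, c′ ≤ 6` and phases `ζ, ζ′ ∈ μ₄`: `c ℓ_ζ − c′ ℓ_{ζ′}` is psd (the difference
`N − P` is EFFECTIVE on that factor) iff `c′ = 0 ∨ (ζ = ζ′ ∧ c′ ≤ c)` — THEOREM L^ζ (P0) ∕ referee O2 = W4; on supp D₄₅ this
is the factorwise rule behind the 9 232 dominant pairs of (6.7)(i) («psd ⟺ factorwise P uncharged or same phase with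
c_P ≤ c_N, 0 exceptions over all 3 140 352 pairs»). (s4-ref g66 «(P0) psd criterion: 784 cases».) [kernel, `decide`] -/
theorem effectivity_rule_table :
    ∀ c c' : Fin 7, ∀ z z' : Fin 4,
      letterDiffPSD c.val z c'.val z' = true ↔ (c'.val = 0 ∨ (z = z' ∧ c'.val ≤ c.val)) := by
  decide +kernel

/-- `|cζ − c′ζ′|²` per phase pair as an integer polynomial: `c² + c′² − 2ρcc′` with `ρ = Re(ζ ζ̄′) ∈ {1, −1, 0}` (same ∕ opposite ∕
orthogonal phases). [kernel, `fin_cases` + `simp` + `ring`] -/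
theorem norm_letterDiff (c c' : ℕ) (z z' : Fin 4) :
    ((c : GaussianInt) * phase z - (c' : GaussianInt) * phase z').norm =
      (c : ℤ) * c + (c' : ℤ) * c' - 2 * (if z = z' then 1 else if (z.val + 2) % 4 = z'.val then -1 else 0) * c * c' := by
  fin_cases z <;> fin_cases z' <;> simp [phase, Zsqrtd.norm_def, Zsqrtd.re_sub, Zsqrtd.im_sub] <;> ring

/-- Arithmetic step of (P0): `c′ ≤ c` and `c·c′ ≤ 0` force `c′ = 0`. [kernel, `nlinarith`] -/
theorem charge_eq_zero_of_le_of_mul_nonpos (c c' : ℕ) (h1 : c' ≤ c) (h2 : (c : ℤ) * c' ≤ 0) : c' = 0 := by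
  rcases Nat.eq_zero_or_pos c' with h | h
  · exact h
  · exfalso
    have hc : (0 : ℤ) < c := by exact_mod_cast lt_of_lt_of_le h h1
    have hc' : (0 : ℤ) < c' := by exact_mod_cast h
    nlinarith

/-- **(P0) EFFECTIVITY RULE, ALL CHARGES** (THEOREM L^ζ §5 (P0); referee O2 = W4 first clause): for every `c, c′ ∈ ℕ` and
`ζ, ζ′ ∈ μ₄`, `c ℓ_ζ − c′ ℓ_{ζ′}` is psd iff `c′ = 0 ∨ (ζ = ζ′ ∧ c′ ≤ c)` — «on every factor P is uncharged or has N's phase with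
`c′ ≤ c`». Since `N − P` on a common `t`-layer is the direct sum of its four factor blocks, this is the whole dominance relation
of the phase alphabet (every one of the 3 140 352 `(N, P)` pairs of supp D₄₅ included, (6.7)(i)). [kernel, `fin_cases` + `nlinarith`] -/
theorem effectivity_rule (c c' : ℕ) (z z' : Fin 4) :
    letterDiffPSD c z c' z' = true ↔ (c' = 0 ∨ (z = z' ∧ c' ≤ c)) := by
  simp only [letterDiffPSD, Bool.and_eq_true, decide_eq_true_eq, norm_letterDiff]
  fin_cases z <;> fin_cases z' <;> simp
  all_goals first
    | (constructor
       · rintro ⟨h1, -⟩; exact Or.inr h1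
       · intro h; refine ⟨?_, by nlinarith⟩; rcases h with h | h <;> omega)
    | (constructor
       · rintro ⟨h1, h2⟩; exact charge_eq_zero_of_le_of_mul_nonpos c c' h1 (by nlinarith)
       · rintro rfl; simp)

/-- The layer-locality line (LL) of E7-TWIN v1.2 ∕ THEOREM-L §0 conventions, squared form: for a layer shift `s` the block
`s·I₂ + (c ℓ_ζ − c′ ℓ_{ζ′})` has eigenvalues `(s + d) ± |w|`; «an eigenvalue of the strict sign of `s`» reads, for `s > 0`,
`s + d > 0 ∨ |w|² > (s + d)²`, and for `s < 0`, `s + d < 0 ∨ |w|² > (s + d)²`. Boolean test. [model datum] -/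
def layerEigenSign (s : ℤ) (c : ℕ) (z : Fin 4) (c' : ℕ) (z' : Fin 4) : Bool :=
  let sd : ℤ := s + ((c : ℤ) - c')
  let n : ℤ := ((c : GaussianInt) * phase z - (c' : GaussianInt) * phase z').norm
  if 0 < s then decide (0 < sd) || decide (sd * sd < n) else decide (sd < 0) || decide (sd * sd < n)

/-- **TABLE (LL) (1 568∕1 568 and more).** For every shift `s ∈ {±1, …, ±6}`, charges `c, c′ ≤ 6`, phases `ζ, ζ′ ∈ μ₄`:
`s·I₂ + (c ℓ_ζ − c′ ℓ_{ζ′})` has an eigenvalue of the strict sign of `s` (the referee's 1 568 cases are `s = ±3`).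
[kernel, `decide`] -/
theorem layer_eigenvalue_sign_table :
    ∀ s : Fin 6, ∀ c c' : Fin 7, ∀ z z' : Fin 4,
      layerEigenSign ((s.val : ℤ) + 1) c.val z c'.val z' = true ∧ layerEigenSign (-((s.val : ℤ) + 1)) c.val z c'.val z' = true := by
  decide +kernel

/-- `|w|² ≥ d²` for the letter difference: `|cζ − c′ζ′|² − (c − c′)² = 2cc′(1 − Re ζζ̄′) ≥ 0`. [kernel, `nlinarith`] -/
theorem sq_le_norm_letterDiff (c c' : ℕ) (z z' : Fin 4) :
    ((c : ℤ) - c') * ((c : ℤ) - c') ≤ ((c : GaussianInt) * phase z - (c' : GaussianInt) * phase z').norm := by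
  rw [norm_letterDiff]
  have hc : (0 : ℤ) ≤ c := by positivity
  have hc' : (0 : ℤ) ≤ c' := by positivity
  split_ifs <;> nlinarith [mul_nonneg hc hc']

/-- **(LL) LAYER LINE, ALL SHIFTS AND CHARGES** (E7-TWIN v1.2 (LL) ∕ THEOREM-L §0 «per factor `s·I₂ + Δx·ℓ_f` has an eigenvalue
of the sign of `s`», phase form): for every `s ≠ 0`, `c, c′ ∈ ℕ`, `ζ, ζ′ ∈ μ₄` the block `s·I₂ + (c ℓ_ζ − c′ ℓ_{ζ′})` has an
eigenvalue of the strict sign of `s` (`(s+d) + |w| > 0` for `s > 0`, `(s+d) − |w| < 0` for `s < 0`, squared). [kernel, `nlinarith`] -/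
theorem layer_eigenvalue_sign (s : ℤ) (hs : s ≠ 0) (c c' : ℕ) (z z' : Fin 4) :
    layerEigenSign s c z c' z' = true := by
  have key := sq_le_norm_letterDiff c c' z z'
  simp only [layerEigenSign]
  split_ifs with h <;> simp only [Bool.or_eq_true, decide_eq_true_eq]
  · by_cases h1 : 0 < s + ((c : ℤ) - c')
    · exact Or.inl h1
    · right; nlinarith
  · have h' : s < 0 := lt_of_le_of_ne (not_lt.mp h) hs
    by_cases h1 : s + ((c : ℤ) - c') < 0
    · exact Or.inl h1
    · right; nlinarith


/-! ## §A4 Charge-free forms of the phase steps (linearity in the charges) -/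

/-- The `s`-letter's unit pair piece `κ(ξ_{ζs}) ∧ ξ̄_{ζs}` in direction `k` (charge 1 on `s = 0`, nothing on `f = 1`). [model datum] -/
def sUnitPiece (ζs : GaussianInt) (k : TW) : Vec4 := wedgePiece (kappaXi k 0 ζs) (xibar 0 ζs) 0 1

/-- LINEARITY: the F-test of the flag's pair piece is `a` times the F-test of the `s`-letter's unit piece — the `f`-letter's piece
`κ(ξ_f) ∧ ξ̄_f` lies in `V_s ⊗ ξ̄_f` identically and contributes nothing, for EVERY direction `k ∈ T_W` and all charges. [kernel, `ring`] -/
theorem contractF_imPiece (k : TW) (a ζs h ζf : GaussianInt) :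
    contractF ζf (imPiece 0 1 a ζs h ζf k) =
      (a * (contractF ζf (sUnitPiece ζs k)).1, a * (contractF ζf (sUnitPiece ζs k)).2) := by
  simp [contractF, imPiece, sUnitPiece, Vec4.add, Vec4.smul, wedgePiece, xibar, kappaXi, kappaA, kappaB]
  all_goals (try constructorm* _ ∧ _)
  all_goals ring

/-- The ONE witness direction `κ₀ = E_{fs} = E_{10}` (`k_{fσ} = 1`, i.e. `κ₀(e_{A_s}) = ē_{B_f}` — the direction named in
THEOREM-L §5 [O6]) works at unit charge for ALL 16 phase pairs. [kernel, `decide`] -/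
theorem leakDir_spec : ∀ zs zf : Fin 4, contractF (phase zf) (sUnitPiece (phase zs) (stdDir 1 0)) ≠ (0, 0) := by
  decide +kernel

/-- **(L1) FOR ALL CHARGES.** For every phase pair and ALL charges `a ≥ 1`, `h ≥ 0` the pair piece of the flag
`X = a ℓ_{ζs}^{(s)} + h ℓ_{ζf}^{(f)}` in the direction `κ₀ = E_{fs}` (`k_{fσ} = 1`) is NOT in `V_s ⊗ Ξ_f` — the LEAK demand of
THEOREM L^ζ (L1)∕(P2) at a top flag of any height, with the uniform witness of [O6]. [kernel: linearity + `leakDir_spec` + `ℤ[i]`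
a domain] -/
theorem leak_demand_all_charges (zs zf : Fin 4) (a h : ℕ) (ha : a ≠ 0) :
    contractF (phase zf) (imPiece 0 1 (a : GaussianInt) (phase zs) (h : GaussianInt) (phase zf) (stdDir 1 0)) ≠ (0, 0) := by
  have hw := leakDir_spec zs zf
  rw [contractF_imPiece]
  have ha' : (a : GaussianInt) ≠ 0 := by exact_mod_cast ha
  intro hzero
  apply hw
  simp only [Prod.mk.injEq, mul_eq_zero, ha', false_or] at hzero
  exact Prod.ext hzero.1 hzero.2

/-- **C′(⇒) FOR ALL CHARGES AND ALL DIRECTIONS.** For EVERY `κ ∈ T_W` (any matrix `k`, not only the basis), all charges `a, h` and all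
`ζs, ζf`, the flag's pair piece decomposes as `ξ̄_{ζs} ⊗ u + v ⊗ ξ̄_{ζf}` (explicit `decomp`): a ring identity. [kernel, `ring`] -/
theorem cprime_containment_all (k : TW) (a ζs h ζf : GaussianInt) :
    recompose ζs ζf (decomp ζs (imPiece 0 1 a ζs h ζf k)) = imPiece 0 1 a ζs h ζf k := by
  simp [recompose, decomp, imPiece, Vec4.add, Vec4.smul, tens, xib, wedgePiece, xibar, kappaXi, kappaA, kappaB]
  ring

/-- **(P3) CONTAINMENT FOR ALL CHARGES AND ALL DIRECTIONS.** For every `κ ∈ T_W`, charge `h` and phase `ζ`, the `(f,τ)`-piece of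
`Im(Q̃)`, `Q̃ = h ℓ_ζ^{(f)}`, equals `ξ̄_ζ ⊗ u` with `u = qtildeU` — it lies in `ξ̄_f ⊗ V_τ`. [kernel, `ring`] -/
theorem qtilde_in_plane_all (k : TW) (h ζ : GaussianInt) :
    tens (xib ζ) (qtildeU (imPiece 1 2 h ζ 0 0 k)) = imPiece 1 2 h ζ 0 0 k := by
  simp [qtildeU, imPiece, Vec4.add, Vec4.smul, tens, xib, wedgePiece, xibar, kappaXi, kappaA, kappaB]
  all_goals (try constructorm* _ ∧ _)
  all_goals ring

/-- The `u`-determinant of the two directions `E_{τf}`, `E_{fτ}` at charge `h` is `h²` times the unit one. [kernel, `ring`] -/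
theorem qtilde_det_smul (h ζ : GaussianInt) :
    (qtildeU (imPiece 1 2 h ζ 0 0 (stdDir 2 1))).1 * (qtildeU (imPiece 1 2 h ζ 0 0 (stdDir 1 2))).2
      - (qtildeU (imPiece 1 2 h ζ 0 0 (stdDir 2 1))).2 * (qtildeU (imPiece 1 2 h ζ 0 0 (stdDir 1 2))).1 =
    h * h * ((qtildeU (imPiece 1 2 1 ζ 0 0 (stdDir 2 1))).1 * (qtildeU (imPiece 1 2 1 ζ 0 0 (stdDir 1 2))).2
      - (qtildeU (imPiece 1 2 1 ζ 0 0 (stdDir 2 1))).2 * (qtildeU (imPiece 1 2 1 ζ 0 0 (stdDir 1 2))).1) := by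
  simp [qtildeU, imPiece, Vec4.add, Vec4.smul, wedgePiece, xibar, kappaXi, kappaA, kappaB, stdDir]
  ring

/-- **(P3) ESCAPE FOR ALL CHARGES.** For every `f`-phase and EVERY charge `h ≥ 1` the two directions `E_{τf}`, `E_{fτ}` give
independent `u`-vectors, so the `(f,τ)`-pieces of `Im(Q̃)` span `ξ̄_f ⊗ V_τ` (dim 2) — `h ξ̄_ζ ⊗ κ(ξ_ζ)_τ ≠ 0` for suitable `κ`,
outside every σ-plane, whatever the height `h` of `Q̃`. [kernel: `qtilde_det_smul` + the 4-case unit table + `ℤ[i]` a domain] -/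
theorem qtilde_escape_all_charges (zf : Fin 4) (h : ℕ) (hh : h ≠ 0) :
    (qtildeU (imPiece 1 2 (h : GaussianInt) (phase zf) 0 0 (stdDir 2 1))).1 *
        (qtildeU (imPiece 1 2 (h : GaussianInt) (phase zf) 0 0 (stdDir 1 2))).2
      - (qtildeU (imPiece 1 2 (h : GaussianInt) (phase zf) 0 0 (stdDir 2 1))).2 *
        (qtildeU (imPiece 1 2 (h : GaussianInt) (phase zf) 0 0 (stdDir 1 2))).1 ≠ 0 := by
  have unit : ∀ z : Fin 4,
      (qtildeU (imPiece 1 2 1 (phase z) 0 0 (stdDir 2 1))).1 * (qtildeU (imPiece 1 2 1 (phase z) 0 0 (stdDir 1 2))).2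
        - (qtildeU (imPiece 1 2 1 (phase z) 0 0 (stdDir 2 1))).2 * (qtildeU (imPiece 1 2 1 (phase z) 0 0 (stdDir 1 2))).1
        ≠ 0 := by
    decide +kernel
  rw [qtilde_det_smul]
  have hh' : (h : GaussianInt) ≠ 0 := by exact_mod_cast hh
  exact mul_ne_zero (mul_ne_zero hh' hh') (unit zf)

end Summit.Ventures.HSemireg.Pad4PhaseKernel
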